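import Mathlib
import Summits.NavierStokesRegularity.NavierStokesRegularity.Theorems.WakeRatchetTailRatchetUniformFrontRH
import HarnessLib

/-!
# Travelling fronts of the UNIFORM dyadic lattice (inner problem H-in of the construction `DyadicScalarFronts`):
# the pointwise integrated energy law and STRICT POSITIVITY of a non-trivial non-negative front

Helper for stmt-NavierStokesRegularity-21808 (`WakeRatchet.TailRatchet`, dead modulo the construction
`WakeRatchetDyadicFront.DyadicScalarFronts`, whose parameter-free inner problem H-in is a travelling front
`X_n(t) = ψ(t − nT)` of the uniform dyadic lattice `Ẋ_n = X_{n−1}² − X_n X_{n+1}`: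
`ψ' = ψ(·+T)² − ψ·ψ(·−T)`, `ψ(−∞) = 0`, `ψ(+∞) = ψ₊ = 1/(2T)`; tree: `WakeRatchetUniformFront.front_level_eq`,
`WakeRatchetInnerFront.*`).  Two elementary a-priori facts every existence scheme (shooting, continuation, certificate)
uses, not exported so far:

* `energy_window_law` — the POINTWISE integrated law `ψ(B)²/2 = ∫_{B−T}^{B} ψ(y)ψ(y+T)² dy` for every `B` (the energy
  sitting in a shell equals the flux through the trailing window of length `T`), for any profile with `ψ(−∞) = 0`
  (step 1 of the tree's Rankine–Hugoniot proof, now a named lemma);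
* `front_pos` — a NON-NEGATIVE profile with non-zero plateau `ψ₊ ≠ 0` is STRICTLY POSITIVE everywhere: at a zero
  `y₀` of `ψ ≥ 0` the derivative vanishes, so `ψ(y₀+T)² = ψ'(y₀) + ψ(y₀)ψ(y₀−T) = 0`, and inductively
  `ψ(y₀ + nT) = 0` for all `n`, contradicting `ψ → ψ₊ ≠ 0`.  (So positive fronts have no touch-down; the leading edge is
  a genuine doubly-exponential tail, cf. `WakeRatchetInnerFront.subTail_eventually`.)

HONEST FRAMING: elementary facts about a MODEL lattice ODE (uniform Desnyansky–Novikov / Katz–Pavlović chain, Tao 2016 §1.2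
with λ = 1); existence of the front (H-in) is NOT proved; nothing here concerns the Navier–Stokes equations; no item is closed.
-/

noncomputable section

set_option linter.dupNamespace false

namespace Summit.NavierStokesRegularity.NavierStokesRegularity.Theorems

namespace WakeRatchetUniformFront

open Filter Topology MeasureTheory intervalIntegral Set

variable {ψ : ℝ → ℝ} {T : ℝ}

/-- **Pointwise integrated energy law.**  For a global `C¹` profile of `ψ' = ψ(·+T)² − ψ·ψ(·−T)` (`T ≥ 0`) with
`ψ → 0` at `−∞`: `ψ(B)²/2 = ∫_{B−T}^{B} ψ(y) ψ(y+T)² dy` for every `B`.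
[cite: Tao2016AveragedNS, §1.2 (energy transfer of the dyadic model); elementary] -/
theorem energy_window_law (hT : 0 ≤ T) (hψ : ∀ y, HasDerivAt ψ (ψ (y + T) ^ 2 - ψ y * ψ (y - T)) y)
    (hbot : Tendsto ψ atBot (𝓝 0)) (B : ℝ) :
    ψ B ^ 2 / 2 = ∫ y in (B - T)..B, ψ y * ψ (y + T) ^ 2 := by
  have hPbot : Tendsto (fun y => ψ y * ψ (y + T) ^ 2) atBot (𝓝 0) := by
    have h1 : Tendsto (fun y => ψ (y + T)) atBot (𝓝 0) :=
      hbot.comp (tendsto_atBot_add_const_right _ _ tendsto_id)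
    have h2 : Tendsto (fun y => ψ y * ψ (y + T) ^ 2) atBot (𝓝 (0 * 0 ^ 2)) := hbot.mul (h1.pow 2)
    norm_num at h2
    exact h2
  have e : ∀ A : ℝ, ψ A ^ 2 / 2 - (∫ y in (A - T)..A, ψ y * ψ (y + T) ^ 2)
      = ψ B ^ 2 / 2 - ∫ y in (B - T)..B, ψ y * ψ (y + T) ^ 2 := by
    intro A
    linarith [energy_balance hψ A B]
  have hA : Tendsto (fun A : ℝ => ψ A ^ 2 / 2 - ∫ y in (A - T)..A, ψ y * ψ (y + T) ^ 2) atBot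
      (𝓝 (0 ^ 2 / 2 - 0)) :=
    ((hbot.pow 2).div_const 2).sub (tendsto_window_integral_atBot hT hPbot)
  have hA' : Tendsto (fun _ : ℝ => ψ B ^ 2 / 2 - ∫ y in (B - T)..B, ψ y * ψ (y + T) ^ 2) atBot
      (𝓝 (0 ^ 2 / 2 - 0)) := hA.congr e
  have h3 := tendsto_nhds_unique tendsto_const_nhds hA'
  norm_num at h3
  linarith

/-- At a zero of a non-negative profile the next shell value vanishes too: `ψ ≥ 0`, `ψ(y₀) = 0` ⟹ `ψ(y₀ + T) = 0`
(the zero is a minimum, so `ψ'(y₀) = 0 = ψ(y₀+T)² − 0`). [elementary] -/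
theorem zero_step (hψ : ∀ y, HasDerivAt ψ (ψ (y + T) ^ 2 - ψ y * ψ (y - T)) y) (hnn : ∀ y, 0 ≤ ψ y)
    {y₀ : ℝ} (h0 : ψ y₀ = 0) : ψ (y₀ + T) = 0 := by
  have hmin : IsLocalMin ψ y₀ := Filter.Eventually.of_forall fun y => by rw [h0]; exact hnn y
  have hd : ψ (y₀ + T) ^ 2 - ψ y₀ * ψ (y₀ - T) = 0 := hmin.hasDerivAt_eq_zero (hψ y₀)
  rw [h0, zero_mul, sub_zero] at hd
  exact pow_eq_zero_iff (n := 2) (by norm_num) |>.1 hd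

/-- Iterating `zero_step`: `ψ(y₀) = 0` ⟹ `ψ(y₀ + nT) = 0` for every `n : ℕ`. [elementary] -/
theorem zero_iterate (hψ : ∀ y, HasDerivAt ψ (ψ (y + T) ^ 2 - ψ y * ψ (y - T)) y) (hnn : ∀ y, 0 ≤ ψ y)
    {y₀ : ℝ} (h0 : ψ y₀ = 0) (n : ℕ) : ψ (y₀ + n * T) = 0 := by
  induction n with
  | zero => simpa using h0
  | succ n ih =>
    have := zero_step hψ hnn ih
    rw [show y₀ + ((n + 1 : ℕ) : ℝ) * T = y₀ + n * T + T by push_cast; ring]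
    exact this

/-- **Strict positivity of a non-trivial non-negative front.**  A global `C¹` profile of `ψ' = ψ(·+T)² − ψ·ψ(·−T)` with
`T > 0`, `ψ ≥ 0` and `ψ → ψ₊ ≠ 0` at `+∞` has no zero: `ψ(y) > 0` for every `y`.
[cite: Tao2016AveragedNS, §1.2 (dyadic model); elementary] -/
theorem front_pos (hT : 0 < T) (hψ : ∀ y, HasDerivAt ψ (ψ (y + T) ^ 2 - ψ y * ψ (y - T)) y)
    (hnn : ∀ y, 0 ≤ ψ y) {ψp : ℝ} (htop : Tendsto ψ atTop (𝓝 ψp)) (hne : ψp ≠ 0) (y : ℝ) : 0 < ψ y := by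
  rcases (hnn y).eq_or_lt with h0 | hpos
  · exfalso
    -- along `y + nT → +∞` the profile vanishes, so `ψ₊ = 0`
    have hseq : Tendsto (fun n : ℕ => y + n * T) atTop atTop :=
      tendsto_atTop_add_const_left _ _ (tendsto_natCast_atTop_atTop.atTop_mul_const hT)
    have hlim : Tendsto (fun n : ℕ => ψ (y + n * T)) atTop (𝓝 ψp) := htop.comp hseq
    have hzero : (fun n : ℕ => ψ (y + n * T)) = fun _ => 0 := funext fun n => zero_iterate hψ hnn h0.symm n
    rw [hzero] at hlim
    exact hne (tendsto_nhds_unique hlim tendsto_const_nhds)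
  · exact hpos

/-- **Strict positivity, `IsTW` form** (the tree's travelling-wave vocabulary for the scalar dyadic structure maps on
the uniform lattice, `(d, c₁, c₂) = (0, 1, 1)`). [cite: Tao2016AveragedNS, §1.2, §4 (4.8); cell vocabulary (`IsTW`)] -/
theorem front_pos_of_isTW (hT : 0 < T)
    (h : Literature.Analysis.FluidPDE.TaoCascade.IsTW (V := ℝ) (fun _ => 0) (fun x => x ^ 2)
      (fun y x => -(x * y)) 0 1 1 T ψ)
    (hnn : ∀ y, 0 ≤ ψ y) {ψp : ℝ} (htop : Tendsto ψ atTop (𝓝 ψp)) (hne : ψp ≠ 0) (y : ℝ) : 0 < ψ y :=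
  front_pos hT (of_isTW h) hnn htop hne y

end WakeRatchetUniformFront

end Summit.NavierStokesRegularity.NavierStokesRegularity.Theorems

end
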